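import Summits.Ventures.WeilGRH.TwistedComplexDataRungJ
import Summits.Ventures.WeilGRH.TwistedGramOddComplex
import Summits.Ventures.WeilGRH.TwistedOddParityFar
import Summits.Ventures.WeilGRH.TwistedSechColumns
import Summits.RiemannHypothesis.RiemannHypothesis.Theorems.WeilFormatCTailEven
import HarnessLib

/-!
# GRH arm (rh-explicit, venture WeilGRH): the parity-1 kernel of a COMPLEX odd character is real symmetric, and the
  `sech` columns have an isotropic tail on signed modes

Cell `rh-explicit`, WEIL TRACK — GRH ARM (lit/typing seat weil-grh-5 gen12; weil-grh-2 gen8's ASK, STATUS 1 (3)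
2026-08-23T12:19Z: «the 46 odd complex cells of conductor ≤ 29 have a NEGATIVE parity-0 block — a parity-1 COMPLEX door»).
weil-grh-1's hermitian kernel of an ODD character with complex values on Yoshida's exponential basis is
`K = twistedGramCoeffOddC χ a = twistedGramCoeffC χ a + (π δ − sechIncrCoeff a)` (`TwistedGramOddComplex.lean`).  Typed
here, as the inputs of the data-only door `TwistedOddComplexDataRungJ.lean`:

* `twistedGramCoeffOddC_im` / `re_twistedGramCoeffOddC` / `twistedGramCoeffOddC_comm` — `K` is REAL SYMMETRIC on `ℤ`-modes
  (the parity-0 kernel is, `TwistedGramCoeffCReal.lean`; the bonus block `πδ − sechIncrCoeff a` is real symmetric by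
  construction), `Re K(n,m) = Re G^χ_C(n,m) + (π δ_{nm} − sechIncrCoeff a n m)`;
* `weilPositivityOnChar_of_twistedGramCoeffOddC_re_psd` — ONE real PSD statement per `N` (the real matrix `Re K` on
  `modes N`) ⟹ `WeilPositivityOnChar χ a` for `χ` odd, `q ≠ 1`, `a > 0`;
* `abs_sechBonus_signed_far_le` — the bonus column on SIGNED modes: for `|n| < B`, `|m| ≥ B₃ ≥ 2B`,
  `|πδ_{nm} − sechIncrCoeff a n m| = |I_m − I_n|/(π|n − m|) ≤ (a/π²)(1 + 1/B₃)/(|m| − B + 1)`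
  (`I_p = ∫_{(0,2a]} σ sin(πpt/a)`, `|p|·|I_p| ≤ a/π`, `I_{−p} = −I_p`: `TwistedSechColumns.lean`);
* `sechBonus_tail_isotropic_enum` — on the enumeration `κ` of the modes (`κ(p) = 2|p| − 1` for `p > 0`, `2|p|` else) the
  far `sech` columns have the ISOTROPIC tail
  `Σ_{j ≥ 2B₃−1} (Σ_i Π(ι i, ι j) x_i)²/W((j+1)/2) ≤ c_S ‖x‖²`,
  `c_S = (2B − 1)·2(a(1 + 1/B₃)/π²)²/((B₃ − B)·d₀)` whenever `W(m) ≥ d₀ > 0` for `m ≥ B₃`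
  (Cauchy–Schwarz over the block, both signs of `m`, `Σ_{k ≥ B₃−B+1} k⁻² ≤ 1/(B₃ − B)`).

No definitions; no named facts; RH/GRH-free; standard axioms.
-/

set_option autoImplicit false

noncomputable section

open Complex Finset MeasureTheory Set
open scoped Real BigOperators ComplexConjugate

namespace Summit.Ventures.WeilGRH

open Literature.NumberTheory.LFunctions
open Literature.NumberTheory.LFunctions.Yoshida1992 (modes mem_modes)
open Summit.RiemannHypothesis.RiemannHypothesis.Theorems.WeilFormatC

variable {q : ℕ} {a : ℝ}

/-! ## 1. The parity-1 complex kernel is real symmetric; one real quadratic form -/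

section Real

/-- `Im K(n,m) = 0` for `K = twistedGramCoeffOddC χ a` (every character). -/
theorem twistedGramCoeffOddC_im (χ : DirichletCharacter ℂ q) (a : ℝ) (n m : ℤ) :
    (twistedGramCoeffOddC χ a n m).im = 0 := by
  unfold twistedGramCoeffOddC
  rw [Complex.add_im, twistedGramCoeffC_im, Complex.ofReal_im, add_zero]

/-- `Re K(n,m) = Re G^χ_C(n,m) + (π δ_{nm} − sechIncrCoeff a n m)`. -/
theorem re_twistedGramCoeffOddC (χ : DirichletCharacter ℂ q) (a : ℝ) (n m : ℤ) :
    (twistedGramCoeffOddC χ a n m).re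
      = (twistedGramCoeffC χ a n m).re + ((if n = m then π else 0) - sechIncrCoeff a n m) := by
  unfold twistedGramCoeffOddC
  rw [Complex.add_re, Complex.ofReal_re]

/-- Symmetry `K(n,m) = K(m,n)` (hermitian + real). -/
theorem twistedGramCoeffOddC_comm (χ : DirichletCharacter ℂ q) (a : ℝ) (n m : ℤ) :
    twistedGramCoeffOddC χ a n m = twistedGramCoeffOddC χ a m n := by
  apply Complex.ext
  · have h := congrArg Complex.re (twistedGramCoeffOddC_conj_symm χ a n m)
    rw [Complex.conj_re] at h
    exact h.symm
  · rw [twistedGramCoeffOddC_im, twistedGramCoeffOddC_im]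

/-- **The hermitian form of `K` is one real quadratic form on real and imaginary parts**:
`Re Σ conj(c_n) c_m K(n,m) = Σ (Re c_n Re c_m + Im c_n Im c_m) Re K(n,m)`. -/
theorem re_sum_sum_conj_mul_twistedGramCoeffOddC (χ : DirichletCharacter ℂ q) (a : ℝ) (s : Finset ℤ) (c : ℤ → ℂ) :
    (∑ n ∈ s, ∑ m ∈ s, conj (c n) * c m * twistedGramCoeffOddC χ a n m).re
      = ∑ n ∈ s, ∑ m ∈ s, ((c n).re * (c m).re + (c n).im * (c m).im) * (twistedGramCoeffOddC χ a n m).re := by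
  rw [Complex.re_sum]
  refine Finset.sum_congr rfl fun n _ ↦ ?_
  rw [Complex.re_sum]
  refine Finset.sum_congr rfl fun m _ ↦ ?_
  rw [Complex.mul_re, twistedGramCoeffOddC_im, mul_zero, sub_zero]
  simp only [Complex.mul_re, Complex.conj_re, Complex.conj_im]
  ring

/-- **ONE real PSD statement per `N` certifies an odd character (complex values allowed).**  For `q ≠ 1`, `χ` odd
(`charParity χ = 1`), `a > 0`: if the real symmetric matrix `(Re K(n,m))_{n,m ∈ modes N}` is positive semidefinite
for every `N`, then `WeilPositivityOnChar χ a`. -/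
theorem weilPositivityOnChar_of_twistedGramCoeffOddC_re_psd (hq : q ≠ 1) (χ : DirichletCharacter ℂ q)
    (hodd : charParity χ = 1) (ha : 0 < a)
    (h : ∀ (N : ℕ) (x : ℤ → ℝ),
      0 ≤ ∑ n ∈ modes N, ∑ m ∈ modes N, x n * x m * (twistedGramCoeffOddC χ a n m).re) :
    WeilPositivityOnChar χ a := by
  refine weilPositivityOnChar_of_twistedGramCoeffOddC_psd hq χ hodd ha fun N c ↦ ?_
  have e : ∑ n ∈ modes N, ∑ m ∈ modes N, (conj (c n) * c m * twistedGramCoeffOddC χ a n m).re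
      = (∑ n ∈ modes N, ∑ m ∈ modes N, conj (c n) * c m * twistedGramCoeffOddC χ a n m).re := by
    rw [Complex.re_sum]
    exact Finset.sum_congr rfl fun n _ ↦ (Complex.re_sum _ _).symm
  rw [e, re_sum_sum_conj_mul_twistedGramCoeffOddC]
  have hsplit : ∑ n ∈ modes N, ∑ m ∈ modes N,
        ((c n).re * (c m).re + (c n).im * (c m).im) * (twistedGramCoeffOddC χ a n m).re
      = (∑ n ∈ modes N, ∑ m ∈ modes N, (c n).re * (c m).re * (twistedGramCoeffOddC χ a n m).re)
        + ∑ n ∈ modes N, ∑ m ∈ modes N, (c n).im * (c m).im * (twistedGramCoeffOddC χ a n m).re := by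
    rw [← Finset.sum_add_distrib]
    refine Finset.sum_congr rfl fun n _ ↦ ?_
    rw [← Finset.sum_add_distrib]
    exact Finset.sum_congr rfl fun m _ ↦ by ring
  rw [hsplit]
  exact add_nonneg (h N fun n ↦ (c n).re) (h N fun n ↦ (c n).im)

end Real

/-! ## 2. The `sech` bonus columns on signed modes -/

section SechSigned

/-- `|I_p| ≤ a/π` for every signed mode (`I_0 = 0`; else `|p| ≥ 1`). -/
theorem abs_sechSinMoment_le (ha : 0 < a) (p : ℤ) :
    |∫ t in Ioc 0 (2 * a), 1 / (2 * Real.cosh (t / 2)) * Real.sin (π * p / a * t)| ≤ a / π := by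
  by_cases hp : p = 0
  · subst hp
    have h0 := sechSinMoment_zero a
    simp only [Int.cast_zero] at h0 ⊢
    rw [h0, abs_zero]
    positivity
  · have h := abs_mul_abs_sechSinMoment_le ha p
    have hp1 : (1 : ℝ) ≤ |(p : ℝ)| := by
      rw [← Int.cast_abs]; exact_mod_cast Int.one_le_abs hp
    have hI := abs_nonneg (∫ t in Ioc 0 (2 * a), 1 / (2 * Real.cosh (t / 2)) * Real.sin (π * p / a * t))
    nlinarith

/-- `|I_p| ≤ a/(π |p|)` for `p ≠ 0`. -/
theorem abs_sechSinMoment_le_div (ha : 0 < a) {p : ℤ} (hp : p ≠ 0) :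
    |∫ t in Ioc 0 (2 * a), 1 / (2 * Real.cosh (t / 2)) * Real.sin (π * p / a * t)| ≤ a / (π * |(p : ℝ)|) := by
  have h := abs_mul_abs_sechSinMoment_le ha p
  have hpabs : 0 < |(p : ℝ)| := abs_pos.mpr (by exact_mod_cast hp)
  rw [le_div_iff₀ (by positivity)]
  calc |∫ t in Ioc 0 (2 * a), 1 / (2 * Real.cosh (t / 2)) * Real.sin (π * p / a * t)| * (π * |(p : ℝ)|)
      = π * (|(p : ℝ)| * |∫ t in Ioc 0 (2 * a), 1 / (2 * Real.cosh (t / 2)) * Real.sin (π * p / a * t)|) := by ring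
    _ ≤ π * (a / π) := by gcongr
    _ = a := by field_simp

/-- **Off-diagonal bonus entries**: for `n ≠ m`, `|πδ_{nm} − sechIncrCoeff a n m| ≤ (|I_m| + |I_n|)/(π|n − m|)`. -/
theorem abs_sechBonus_offDiag_le (a : ℝ) {n m : ℤ} (hnm : n ≠ m) :
    |(if n = m then π else 0) - sechIncrCoeff a n m|
      ≤ (|∫ t in Ioc 0 (2 * a), 1 / (2 * Real.cosh (t / 2)) * Real.sin (π * m / a * t)|
          + |∫ t in Ioc 0 (2 * a), 1 / (2 * Real.cosh (t / 2)) * Real.sin (π * n / a * t)|)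
        / (π * |(n : ℝ) - m|) := by
  have hnm' : (n : ℝ) - m ≠ 0 := sub_ne_zero.mpr (by exact_mod_cast hnm)
  have hπnm : 0 < π * |(n : ℝ) - m| := by positivity
  unfold sechIncrCoeff
  rw [if_neg hnm, if_neg hnm, zero_sub, abs_neg, abs_mul, abs_div, abs_neg, abs_neg_one_zpow, abs_mul,
    abs_of_pos Real.pi_pos, one_div, ← div_eq_inv_mul]
  exact div_le_div_of_nonneg_right (abs_sub _ _) hπnm.le

/-- `|ι(n)| = (n+1)/2`: the size of the `n`-th enumerated mode. -/
theorem natAbs_iota (n : ℕ) :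
    (if n % 2 = 1 then (((n + 1) / 2 : ℕ) : ℤ) else -((n / 2 : ℕ) : ℤ)).natAbs = (n + 1) / 2 := by
  by_cases h : n % 2 = 1
  · rw [if_pos h, Int.natAbs_natCast]
  · rw [if_neg h, Int.natAbs_neg, Int.natAbs_natCast]
    omega

/-- **The bonus column on SIGNED modes decays like `1/|m|` uniformly over the block**: for `|n| < B`, `B₃ ≤ |m|`,
`2B ≤ B₃`: `|πδ_{nm} − sechIncrCoeff a n m| ≤ (a/π²)(1 + 1/B₃)/(|m| − B + 1)`. -/
theorem abs_sechBonus_signed_far_le (ha : 0 < a) {B B₃ : ℕ} (hB : 1 ≤ B) (hBB : 2 * B ≤ B₃) {n m : ℤ}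
    (hn : n.natAbs < B) (hm : B₃ ≤ m.natAbs) :
    |(if n = m then π else 0) - sechIncrCoeff a n m|
      ≤ a / π ^ 2 * (1 + 1 / (B₃ : ℝ)) / ((m.natAbs - B + 1 : ℕ) : ℝ) := by
  have hnm : n ≠ m := by rintro rfl; omega
  have hm0 : m ≠ 0 := by rintro rfl; simp at hm; omega
  have hB₃pos : (0 : ℝ) < B₃ := by exact_mod_cast (show 0 < B₃ by omega)
  have hmR : (B₃ : ℝ) ≤ |(m : ℝ)| := by
    rw [← Int.cast_abs, Int.abs_eq_natAbs]; exact_mod_cast hm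
  have hnR : |(n : ℝ)| ≤ ((B - 1 : ℕ) : ℝ) := by
    rw [← Int.cast_abs, Int.abs_eq_natAbs]; exact_mod_cast (show n.natAbs ≤ B - 1 by omega)
  -- the denominator
  have hden : ((m.natAbs - B + 1 : ℕ) : ℝ) ≤ |(n : ℝ) - m| := by
    have h1 : ((m.natAbs - B + 1 : ℕ) : ℝ) = (m.natAbs : ℝ) - B + 1 := by
      rw [Nat.cast_add, Nat.cast_sub (by omega), Nat.cast_one]
    have h2 : (m.natAbs : ℝ) = |(m : ℝ)| := by
      rw [← Int.cast_abs, Int.abs_eq_natAbs, Int.cast_natCast]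
    have h3 : ((B - 1 : ℕ) : ℝ) = (B : ℝ) - 1 := by rw [Nat.cast_sub hB, Nat.cast_one]
    rw [h1, h2]
    have h4 : |(m : ℝ)| - |(n : ℝ)| ≤ |(n : ℝ) - m| := by
      rw [abs_sub_comm]; exact abs_sub_abs_le_abs_sub _ _
    linarith
  have hdenpos : (0 : ℝ) < ((m.natAbs - B + 1 : ℕ) : ℝ) := by exact_mod_cast (show 0 < m.natAbs - B + 1 by omega)
  -- the numerator
  have hIm := abs_sechSinMoment_le_div ha hm0
  have hIn := abs_sechSinMoment_le ha n
  have hnum : |∫ t in Ioc 0 (2 * a), 1 / (2 * Real.cosh (t / 2)) * Real.sin (π * m / a * t)|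
        + |∫ t in Ioc 0 (2 * a), 1 / (2 * Real.cosh (t / 2)) * Real.sin (π * n / a * t)|
      ≤ a / π * (1 + 1 / (B₃ : ℝ)) := by
    have h1 : a / (π * |(m : ℝ)|) ≤ a / (π * B₃) := by
      apply div_le_div_of_nonneg_left ha.le (by positivity)
      exact mul_le_mul_of_nonneg_left hmR Real.pi_pos.le
    have h2 : a / (π * B₃) = a / π * (1 / (B₃ : ℝ)) := by field_simp
    linarith
  calc |(if n = m then π else 0) - sechIncrCoeff a n m|
      ≤ _ := abs_sechBonus_offDiag_le a hnm
    _ ≤ (a / π * (1 + 1 / (B₃ : ℝ))) / (π * ((m.natAbs - B + 1 : ℕ) : ℝ)) := by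
        have hπd : 0 < π * ((m.natAbs - B + 1 : ℕ) : ℝ) := by positivity
        calc _ ≤ (a / π * (1 + 1 / (B₃ : ℝ))) / (π * |(n : ℝ) - m|) :=
              div_le_div_of_nonneg_right hnum (by positivity)
          _ ≤ _ := div_le_div_of_nonneg_left (by positivity) hπd
                (mul_le_mul_of_nonneg_left hden Real.pi_pos.le)
    _ = a / π ^ 2 * (1 + 1 / (B₃ : ℝ)) / ((m.natAbs - B + 1 : ℕ) : ℝ) := by
        field_simp

/-- `Σ_{m ∈ Ico B₃ M} 1/(m − B + 1)² ≤ 1/(B₃ − B)` (`2B ≤ B₃`, `1 ≤ B`; telescoping `1/(y+1)² ≤ 1/y − 1/(y+1)`). -/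
theorem sum_Ico_inv_sq_shift_le {B B₃ : ℕ} (hB : 1 ≤ B) (hBB : 2 * B ≤ B₃) (M : ℕ) :
    ∑ m ∈ Finset.Ico B₃ M, 1 / ((m - B + 1 : ℕ) : ℝ) ^ 2 ≤ 1 / ((B₃ - B : ℕ) : ℝ) := by
  suffices h : ∀ M, B₃ ≤ M →
      ∑ m ∈ Finset.Ico B₃ M, 1 / ((m - B + 1 : ℕ) : ℝ) ^ 2 ≤ 1 / ((B₃ - B : ℕ) : ℝ) - 1 / ((M - B : ℕ) : ℝ) by
    by_cases hM : B₃ ≤ M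
    · exact (h M hM).trans (sub_le_self _ (by positivity))
    · rw [Finset.Ico_eq_empty_of_le (by omega), Finset.sum_empty]
      positivity
  intro M hM
  induction M, hM using Nat.le_induction with
  | base => rw [Finset.Ico_self, Finset.sum_empty, sub_self]
  | succ M hM ih =>
    rw [Finset.sum_Ico_succ_top hM]
    have hMB : 1 ≤ M - B := by omega
    have e1 : ((M - B + 1 : ℕ) : ℝ) = ((M - B : ℕ) : ℝ) + 1 := by push_cast; ring
    have e2 : ((M + 1 - B : ℕ) : ℝ) = ((M - B : ℕ) : ℝ) + 1 := by
      rw [show M + 1 - B = M - B + 1 by omega]; push_cast; ring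
    have h1 : (1 : ℝ) / ((M - B + 1 : ℕ) : ℝ) ^ 2 ≤ 1 / ((M - B : ℕ) : ℝ) - 1 / ((M + 1 - B : ℕ) : ℝ) := by
      rw [e1, e2]
      have hy : (1 : ℝ) ≤ ((M - B : ℕ) : ℝ) := by exact_mod_cast hMB
      have e3 : 1 / ((M - B : ℕ) : ℝ) - 1 / (((M - B : ℕ) : ℝ) + 1) = 1 / (((M - B : ℕ) : ℝ) * (((M - B : ℕ) : ℝ) + 1)) := by
        field_simp
        ring
      rw [e3]
      exact one_div_le_one_div_of_le (by positivity) (by nlinarith)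
    linarith

/-- **Isotropic tail of the bonus columns on the enumeration.**  For `1 ≤ B`, `2B ≤ B₃`, weights `W` with
`W(m) ≥ d₀ > 0` for `m ≥ B₃`, every `N'` and every real block vector `x`:
`Σ_{j ∈ Ico (2B₃−1) N'} (Σ_i Π(ι i, ι j) x_i)² / W((j+1)/2) ≤ c_S Σ_i x_i²`,
`c_S = (2B−1)·2(a(1+1/B₃)/π²)²/((B₃ − B) d₀)`, `Π = πδ − sechIncrCoeff a`. -/
theorem sechBonus_tail_isotropic_enum (ha : 0 < a) {B B₃ : ℕ} (hB : 1 ≤ B) (hBB : 2 * B ≤ B₃)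
    (W : ℕ → ℝ) {d₀ : ℝ} (hd₀ : 0 < d₀) (hd : ∀ m, B₃ ≤ m → d₀ ≤ W m) (N' : ℕ) (x : Fin (2 * B - 1) → ℝ) :
    ∑ j ∈ Finset.Ico (2 * B₃ - 1) N', (∑ i : Fin (2 * B - 1),
        ((ite ((if (i : ℕ) % 2 = 1 then ((((i : ℕ) + 1) / 2 : ℕ) : ℤ) else -((((i : ℕ) / 2 : ℕ) : ℤ))) = (if j % 2 = 1 then (((j + 1) / 2 : ℕ) : ℤ) else -((j / 2 : ℕ) : ℤ))) π 0) - sechIncrCoeff a (if (i : ℕ) % 2 = 1 then ((((i : ℕ) + 1) / 2 : ℕ) : ℤ) else -((((i : ℕ) / 2 : ℕ) : ℤ))) (if j % 2 = 1 then (((j + 1) / 2 : ℕ) : ℤ) else -((j / 2 : ℕ) : ℤ))) * x i) ^ 2 / W ((j + 1) / 2)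
      ≤ ((2 * B - 1 : ℕ) : ℝ) * (2 * (a / π ^ 2 * (1 + 1 / (B₃ : ℝ))) ^ 2 / (((B₃ - B : ℕ) : ℝ) * d₀))
          * ∑ i : Fin (2 * B - 1), x i ^ 2 := by
  have hB₃1 : 1 ≤ B₃ := by omega
  set σ : ℕ → ℝ := fun m ↦ a / π ^ 2 * (1 + 1 / (B₃ : ℝ)) / ((m - B + 1 : ℕ) : ℝ) with hσ
  set X : ℝ := ∑ i : Fin (2 * B - 1), x i ^ 2 with hX
  have hX0 : 0 ≤ X := Finset.sum_nonneg fun i _ ↦ sq_nonneg _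
  -- termwise bound
  have hterm : ∀ j, 2 * B₃ - 1 ≤ j →
      (∑ i : Fin (2 * B - 1), ((ite ((if (i : ℕ) % 2 = 1 then ((((i : ℕ) + 1) / 2 : ℕ) : ℤ) else -((((i : ℕ) / 2 : ℕ) : ℤ))) = (if j % 2 = 1 then (((j + 1) / 2 : ℕ) : ℤ) else -((j / 2 : ℕ) : ℤ))) π 0) - sechIncrCoeff a (if (i : ℕ) % 2 = 1 then ((((i : ℕ) + 1) / 2 : ℕ) : ℤ) else -((((i : ℕ) / 2 : ℕ) : ℤ))) (if j % 2 = 1 then (((j + 1) / 2 : ℕ) : ℤ) else -((j / 2 : ℕ) : ℤ))) * x i) ^ 2 / W ((j + 1) / 2)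
        ≤ ((2 * B - 1 : ℕ) : ℝ) * σ ((j + 1) / 2) ^ 2 * X / d₀ := by
    intro j hj
    have hmj : B₃ ≤ (j + 1) / 2 := by omega
    have hWj : d₀ ≤ W ((j + 1) / 2) := hd _ hmj
    have hWpos : 0 < W ((j + 1) / 2) := hd₀.trans_le hWj
    have hcs := Finset.sum_mul_sq_le_sq_mul_sq (Finset.univ : Finset (Fin (2 * B - 1)))
      (fun i : Fin (2 * B - 1) ↦ ((ite ((if (i : ℕ) % 2 = 1 then ((((i : ℕ) + 1) / 2 : ℕ) : ℤ) else -((((i : ℕ) / 2 : ℕ) : ℤ))) = (if j % 2 = 1 then (((j + 1) / 2 : ℕ) : ℤ) else -((j / 2 : ℕ) : ℤ))) π 0) - sechIncrCoeff a (if (i : ℕ) % 2 = 1 then ((((i : ℕ) + 1) / 2 : ℕ) : ℤ) else -((((i : ℕ) / 2 : ℕ) : ℤ))) (if j % 2 = 1 then (((j + 1) / 2 : ℕ) : ℤ) else -((j / 2 : ℕ) : ℤ)))) x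
    have hentry : ∀ i : Fin (2 * B - 1), ((ite ((if (i : ℕ) % 2 = 1 then ((((i : ℕ) + 1) / 2 : ℕ) : ℤ) else -((((i : ℕ) / 2 : ℕ) : ℤ))) = (if j % 2 = 1 then (((j + 1) / 2 : ℕ) : ℤ) else -((j / 2 : ℕ) : ℤ))) π 0) - sechIncrCoeff a (if (i : ℕ) % 2 = 1 then ((((i : ℕ) + 1) / 2 : ℕ) : ℤ) else -((((i : ℕ) / 2 : ℕ) : ℤ))) (if j % 2 = 1 then (((j + 1) / 2 : ℕ) : ℤ) else -((j / 2 : ℕ) : ℤ))) ^ 2 ≤ σ ((j + 1) / 2) ^ 2 := by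
      intro i
      have hi : (if (i : ℕ) % 2 = 1 then ((((i : ℕ) + 1) / 2 : ℕ) : ℤ) else -((((i : ℕ) / 2 : ℕ) : ℤ))).natAbs < B := by
        rw [natAbs_iota]; have := i.isLt; omega
      have hmj' : B₃ ≤ (if j % 2 = 1 then (((j + 1) / 2 : ℕ) : ℤ) else -((j / 2 : ℕ) : ℤ)).natAbs := by
        rw [natAbs_iota]; exact hmj
      have h := abs_sechBonus_signed_far_le ha hB hBB hi hmj'
      rw [natAbs_iota] at h
      rw [← sq_abs]
      exact pow_le_pow_left₀ (abs_nonneg _) h 2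
    have hsumsq : ∑ i : Fin (2 * B - 1), ((ite ((if (i : ℕ) % 2 = 1 then ((((i : ℕ) + 1) / 2 : ℕ) : ℤ) else -((((i : ℕ) / 2 : ℕ) : ℤ))) = (if j % 2 = 1 then (((j + 1) / 2 : ℕ) : ℤ) else -((j / 2 : ℕ) : ℤ))) π 0) - sechIncrCoeff a (if (i : ℕ) % 2 = 1 then ((((i : ℕ) + 1) / 2 : ℕ) : ℤ) else -((((i : ℕ) / 2 : ℕ) : ℤ))) (if j % 2 = 1 then (((j + 1) / 2 : ℕ) : ℤ) else -((j / 2 : ℕ) : ℤ))) ^ 2 ≤ ((2 * B - 1 : ℕ) : ℝ) * σ ((j + 1) / 2) ^ 2 := by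
      refine (Finset.sum_le_sum fun i _ ↦ hentry i).trans ?_
      rw [Finset.sum_const, Finset.card_univ, Fintype.card_fin, nsmul_eq_mul]
    have hnum0 : 0 ≤ ((2 * B - 1 : ℕ) : ℝ) * σ ((j + 1) / 2) ^ 2 * X := by positivity
    calc _ ≤ ((2 * B - 1 : ℕ) : ℝ) * σ ((j + 1) / 2) ^ 2 * X / W ((j + 1) / 2) := by
          refine div_le_div_of_nonneg_right (hcs.trans ?_) hWpos.le
          exact mul_le_mul_of_nonneg_right hsumsq hX0
      _ ≤ _ := div_le_div_of_nonneg_left hnum0 hd₀ hWj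
  -- sum over the far enumeration, both signs of the mode
  refine (Finset.sum_le_sum fun j hj ↦ hterm j (Finset.mem_Ico.mp hj).1).trans ?_
  have hpair := sum_Ico_enum_le_two_sided (fun j ↦ ((2 * B - 1 : ℕ) : ℝ) * σ ((j + 1) / 2) ^ 2 * X / d₀) hB₃1
    (fun j _ ↦ by positivity) N'
  refine hpair.trans ?_
  have e : ∀ m ∈ Finset.Ico B₃ (N' + 1),
      ((2 * B - 1 : ℕ) : ℝ) * σ ((2 * m - 1 + 1) / 2) ^ 2 * X / d₀ + ((2 * B - 1 : ℕ) : ℝ) * σ ((2 * m + 1) / 2) ^ 2 * X / d₀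
        = (((2 * B - 1 : ℕ) : ℝ) * (2 * (a / π ^ 2 * (1 + 1 / (B₃ : ℝ))) ^ 2) * X / d₀) * (1 / ((m - B + 1 : ℕ) : ℝ) ^ 2) := by
    intro m hm
    have hm1 : 1 ≤ m := le_trans hB₃1 (Finset.mem_Ico.mp hm).1
    have e1 : (2 * m - 1 + 1) / 2 = m := by omega
    have e2 : (2 * m + 1) / 2 = m := by omega
    rw [e1, e2]
    simp only [hσ]
    ring
  rw [Finset.sum_congr rfl e, ← Finset.mul_sum]
  have hsum := sum_Ico_inv_sq_shift_le hB hBB (N' + 1)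
  have hc0 : 0 ≤ ((2 * B - 1 : ℕ) : ℝ) * (2 * (a / π ^ 2 * (1 + 1 / (B₃ : ℝ))) ^ 2) * X / d₀ := by positivity
  calc _ ≤ ((2 * B - 1 : ℕ) : ℝ) * (2 * (a / π ^ 2 * (1 + 1 / (B₃ : ℝ))) ^ 2) * X / d₀ * (1 / ((B₃ - B : ℕ) : ℝ)) :=
        mul_le_mul_of_nonneg_left hsum hc0
    _ = _ := by
        have hBB' : (0 : ℝ) < ((B₃ - B : ℕ) : ℝ) := by exact_mod_cast (show 0 < B₃ - B by omega)
        field_simp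

end SechSigned

end Summit.Ventures.WeilGRH

end
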